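/-
Origin: expansion seat `planner-pub-hodgecm-qw8-g11-0`, handover #29 SPLIT PART 2/3 of tree `HodgeCM/StubTree/Qw8GysinDescent.lean` c37c4c4e (774 l. > 400-line cap) = NEW module `HodgeCM.StubTree.Qw8GysinDescentBox` md5 d19e52dcb78a8af23a9427bd2c9bb8ba (359 l.): verbatim section-boundary slice + docstrings; imports: `import Qw8g11.Qw8GysinDescentBase` -> `import HodgeCM.StubTree.Qw8GysinDescentBase` (row #28); check-wip LANDABLE rc 0 / 0 warnings / 0 proof-hole; lea (`HOME/pub-hodgecm-qw8-g11/lean/Qw8g11/Qw8GysinDescentBox.lean`, md5 d19e52dc, 359 lines);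
landed by the packager successor (mc-unitary-1-g3, gen-8 kit) in gate run 32 as `HodgeCM/StubTree/Qw8GysinDescentBox.lean` (import ^import Qw8g11\.Qw8GysinDescentBase[ \t]*$→import HodgeCM.StubTree.Qw8GysinDescentBase ×1).
-/
-- HANDOVER (planner-pub-hodgecm-qw8-g11-0, unit pub-hodgecm-qw8-g11): SPLIT PART 2/3 of the installed
-- `HodgeCM.StubTree.Qw8GysinDescent` (md5 c37c4c4e, 774 l.) = its §§3b–5 (ll. 229–544: `section BoxPos`, `section Descent`,
-- `section Partner`) verbatim + docstrings; WIP module `Qw8g11.Qw8GysinDescentBox`, intended final module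
-- `HodgeCM.StubTree.Qw8GysinDescentBox` (NEW file); at landing rewrite `import Qw8g11.Qw8GysinDescentBase` ↦ `import HodgeCM.StubTree.Qw8GysinDescentBase`.
/-
Copyright (c) 2026. All rights reserved.
Released under Apache 2.0 license as described in the file LICENSE.
-/
import Summits.HodgeConjecture.HodgeCM.StubTree.Qw8GysinDescentBase

/-!
# F7d `Fact_gysinDescent`, II: `⊠` is injective in positive degree; complex coefficients; the trace-free partner

Split part 2/3 of `HodgeCM.StubTree.Qw8GysinDescent` (its §§3b–5, unchanged).

* §3b `⊠` is injective in POSITIVE degree — a THEOREM of `ModelAxioms` + N1 + F5 (+ `Fact_dimProd`), so F7d (a) carries new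
  content only in degree `0` (where it encodes `H⁰(Y) = ℚ · 1`).
* §4 F7d with complex coefficients: (a)_ℂ and (b)_ℂ for arbitrary nonzero complex top classes (`mem_algC_of_boxC_mem`, …).
* §5 the trace-free partner of a weight vector (the complementary eigen-monomial).

Steps (ii), (iii)+(v), the degree-0 residue and the assembly are in `HodgeCM.StubTree.Qw8GysinDescent`.
-/

noncomputable section

open scoped TensorProduct NumberField Classical

namespace HodgeCM

open Literature.AlgebraicGeometry.Motives (CMType)
open HodgeCM.Pohlmann

namespace Universe

variable {U : Universe}

/-! ## 3b. `⊠` is injective in POSITIVE degree — a THEOREM of `ModelAxioms` + N1 + F5 (+ `Fact_dimProd`)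

So F7d (a) carries new content only in degree `0` (where it encodes `H⁰(Y) = ℚ · 1`, i.e. connectedness, which no
recorded fact asserts); the toy witness `HodgeCM.Toy.fact_gysinDescent` uses these theorems in positive degree. -/

section BoxPos

variable {F : CMField} {n m : ℕ} (Ξ : Fin (n + 1 + (m + 1)) → CMType F)
  {pA : U.Mor (U.cmProd F Ξ) (U.cmProd F (blkA Ξ))} {pB : U.Mor (U.cmProd F Ξ) (U.cmProd F (blkB Ξ))}

/-- the weights `(S, S')` of `P = Y × Y'` determine `S` -/
theorem append_left_injective' (S' : Fin (m + 1) → Finset ((F : Type) →+* ℂ)) :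
    Function.Injective fun S : Fin (n + 1) → Finset ((F : Type) →+* ℂ) =>
      (Fin.append S S' : Fin (n + 1 + (m + 1)) → Finset ((F : Type) →+* ℂ)) := by
  intro S T h
  funext j
  have h' := congrFun h (Fin.castAdd (m + 1) j)
  simpa only [Fin.append_left] using h'

/-- **`p_Y^* x ∪ p_{Y'}^* fmono q ≠ 0`** for `x ≠ 0` of positive degree and an injective eigen-monomial `fmono q`
of `Y'`: decompose `x = Σ_S x_S` into weight vectors (`iSup_weightSpace_succ`, M29 as a theorem); the boxes
`p_Y^* x_S ∪ p_{Y'}^* fmono q` are weight vectors of the DISTINCT weights `(S, wt q)` (`isWeightVector_box'`), hence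
independent (`iSupIndep_weightSpace`); and for `x_S = c · fmono p ≠ 0` (`exists_eq_smul_fmono`) the box is
`c · fmono (append p q) ≠ 0` (`pullC_fmono_blkA/B`, `cupC_fmono_fmono`, `fmono_ne_zero`). -/
theorem boxC_fmono_ne_zero (M : U.ModelAxioms) (hN1 : U.Fact_cupExterior) (h5 : U.Fact_cupAssoc)
    (hP : U.IsBlockPair F Ξ pA pB)
    (xP : (t : Fin (n + 1 + (m + 1))) → ((F : Type) →+* ℂ) → U.CohC (U.cmAV F (Ξ t)) 1)
    (hxP : ∀ t τ, xP t τ ∈ U.eigenLine F (Ξ t) τ) (hsp : ∀ t, Submodule.span ℂ (Set.range (xP t)) = ⊤)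
    {k : ℕ} {x : U.CohC (U.cmProd F (blkA Ξ)) (k + 1)} (hx : x ≠ 0)
    {K : ℕ} {q : Fin (K + 1) → Fin (m + 1) × ((F : Type) →+* ℂ)} (hq : Function.Injective q) :
    U.cupC (U.cmProd F Ξ) (k + 1) (K + 1) (U.pullC pA (k + 1) x)
      (U.pullC pB (K + 1) (U.fmono (Θ := blkB Ξ) (fun i => xP (Fin.natAdd (n + 1) i)) K q)) ≠ 0 := by
  classical
  obtain ⟨ωq, hωq⟩ : ∃ ωq, ωq = U.fmono (Θ := blkB Ξ) (fun i => xP (Fin.natAdd (n + 1) i)) K q := ⟨_, rfl⟩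
  rw [← hωq]
  intro h0
  -- the box map `y ↦ p_Y^* y ∪ p_{Y'}^* ωq`
  obtain ⟨box, hbox⟩ : ∃ box : U.CohC (U.cmProd F (blkA Ξ)) (k + 1) →ₗ[ℂ] U.CohC (U.cmProd F Ξ) (k + 1 + (K + 1)),
      ∀ y, box y = U.cupC (U.cmProd F Ξ) (k + 1) (K + 1) (U.pullC pA (k + 1) y) (U.pullC pB (K + 1) ωq) :=
    ⟨(U.cupC (U.cmProd F Ξ) (k + 1) (K + 1)).flip (U.pullC pB (K + 1) ωq) ∘ₗ U.pullC pA (k + 1), fun y => rfl⟩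
  have hωwt : U.IsWeightVector F (blkB Ξ) (wtOf K q) (K + 1) ωq := by
    rw [hωq]; exact isWeightVector_fmono _ M (fun i τ => hxP _ τ) K q hq
  -- weight decomposition of `x`
  have hxmem : x ∈ ⨆ S, U.weightSpace F (blkA Ξ) S (k + 1) := by
    rw [iSup_weightSpace_succ M hN1 k]; exact Submodule.mem_top
  obtain ⟨f, hf, hfx⟩ := (Submodule.mem_iSup_iff_exists_finsupp _ x).mp hxmem
  obtain ⟨S₀, hS₀⟩ : ∃ S, f S ≠ 0 := by
    by_contra hall
    apply hx
    rw [← hfx, Finsupp.sum]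
    exact Finset.sum_eq_zero fun S _ => not_ne_iff.mp fun h => hall ⟨S, h⟩
  have hS₀mem : S₀ ∈ f.support := Finsupp.mem_support_iff.mpr hS₀
  -- the weights of the boxes of the components are distinct
  obtain ⟨ι, hιdef⟩ : ∃ ι : (Fin (n + 1) → Finset ((F : Type) →+* ℂ)) →
      Fin (n + 1 + (m + 1)) → Finset ((F : Type) →+* ℂ), ∀ S, ι S = Fin.append S (wtOf K q) := ⟨_, fun S => rfl⟩
  have hι : Function.Injective ι := by
    intro S T h
    rw [hιdef, hιdef] at h
    exact append_left_injective' (wtOf K q) h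
  have hboxwt : ∀ S, box (f S) ∈ U.weightSpace F Ξ (ι S) (k + 1 + (K + 1)) := fun S => by
    rw [hbox, hιdef]
    exact (U.mem_weightSpace_iff F Ξ _ _ _).2
      (U.isWeightVector_box' Ξ M hN1 hP (Nat.succ_pos k) (Nat.succ_pos K)
        ((U.mem_weightSpace_iff F (blkA Ξ) S _ _).1 (hf S)) hωwt)
  -- `Σ_S box (f S) = box x = 0`
  have hx' : x = ∑ S ∈ f.support, f S := by rw [← hfx]; rfl
  have hsum : ∑ S ∈ f.support, box (f S) = 0 := by rw [← map_sum, ← hx', hbox]; exact h0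
  have hsplit : box (f S₀) = -∑ S ∈ f.support.erase S₀, box (f S) := by
    rw [← Finset.add_sum_erase _ _ hS₀mem] at hsum
    exact eq_neg_of_add_eq_zero_left hsum
  have hmem2 : box (f S₀) ∈ ⨆ (T) (_ : T ≠ ι S₀), U.weightSpace F Ξ T (k + 1 + (K + 1)) := by
    rw [hsplit]
    refine Submodule.neg_mem _ (Submodule.sum_mem _ fun S hS => ?_)
    have hne : ι S ≠ ι S₀ := fun h => (Finset.mem_erase.mp hS).1 (hι h)
    exact Submodule.mem_iSup_of_mem (ι S) (Submodule.mem_iSup_of_mem hne (hboxwt S))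
  have hzero : box (f S₀) = 0 :=
    Submodule.disjoint_def.1 (iSupIndep_def.1 (iSupIndep_weightSpace (Θ := Ξ) M (k + 1 + (K + 1))) (ι S₀)) _
      (hboxwt S₀) hmem2
  -- but `f S₀ = c • fmono p` (`c ≠ 0`), whose box is `c • fmono (append p q) ≠ 0`
  obtain ⟨p, hp, -, c, hc⟩ := U.exists_eq_smul_fmono (Θ := blkA Ξ) (fun j => xP (Fin.castAdd (m + 1) j)) M hN1
    (fun j τ => hxP _ τ) (fun j => hsp _) ((U.mem_weightSpace_iff F (blkA Ξ) S₀ _ _).1 (hf S₀)) hS₀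
  have hc0 : c ≠ 0 := by rintro rfl; exact hS₀ (by rw [hc, zero_smul])
  rw [hbox, hc, map_smul, map_smul, LinearMap.smul_apply, U.pullC_fmono_blkA Ξ xP M.pull_cup hP, hωq,
    U.pullC_fmono_blkB Ξ xP M.pull_cup hP, U.cupC_fmono_fmono xP h5, smul_eq_zero] at hzero
  rcases hzero with h | h
  · exact hc0 h
  · refine U.fmono_ne_zero xP M hN1 hxP hsp ?_ h
    refine Fin.append_injective_iff.mpr ⟨?_, ?_, ?_⟩
    · intro i i' hii'
      simp only [Prod.mk.injEq, Fin.castAdd_inj] at hii'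
      exact hp (Prod.ext hii'.1 hii'.2)
    · intro i i' hii'
      simp only [Prod.mk.injEq] at hii'
      exact hq (Prod.ext (Fin.natAdd_inj _ |>.mp hii'.1) hii'.2)
    · intro i j hij
      simp only [Prod.mk.injEq] at hij
      have hv := congrArg Fin.val hij.1
      simp only [Fin.val_castAdd, Fin.val_natAdd] at hv
      have := (p i).1.isLt
      omega

/-- **Every top class of a CM product is `c · fmono q`** (transported to monomial degree `K + 1 = 2 dim`):
`H^{2 dim}(A′, ℂ)` is the line spanned by any injective top eigen-monomial (N1 + M22 + `Fact_dimProd`). -/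
theorem exists_top_eq_smul_fmono (M : U.ModelAxioms) (hN1 : U.Fact_cupExterior) (hd : U.Fact_dimProd)
    {F : CMField} {m : ℕ} {Θ' : Fin (m + 1) → CMType F}
    (xB : (i : Fin (m + 1)) → ((F : Type) →+* ℂ) → U.CohC (U.cmAV F (Θ' i)) 1)
    (hxB : ∀ i τ, xB i τ ∈ U.eigenLine F (Θ' i) τ) (hsp : ∀ i, Submodule.span ℂ (Set.range (xB i)) = ⊤)
    (ω : U.CohC (U.cmProd F Θ') (2 * U.dim (U.cmProd F Θ'))) :
    ∃ (K : ℕ) (hK : 2 * U.dim (U.cmProd F Θ') = K + 1) (q : Fin (K + 1) → Fin (m + 1) × ((F : Type) →+* ℂ))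
      (c : ℂ), Function.Injective q ∧ ω = U.castC _ hK.symm (c • U.fmono xB K q) := by
  classical
  have h2d : 2 * U.dim (U.cmProd F Θ') = (m + 1) * Module.finrank ℚ F :=
    U.two_mul_dim_cmProd_of_dimProd M hd F Θ'
  have hFpos : 0 < Module.finrank ℚ F := Module.finrank_pos
  obtain ⟨K, hK⟩ : ∃ K, 2 * U.dim (U.cmProd F Θ') = K + 1 :=
    ⟨2 * U.dim (U.cmProd F Θ') - 1, by
      have h1 : 0 < (m + 1) * Module.finrank ℚ F := Nat.mul_pos (Nat.succ_pos m) hFpos; omega⟩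
  -- an injective enumeration `q` of the index set
  have hcard : Fintype.card (Fin (K + 1)) = Fintype.card (Fin (m + 1) × ((F : Type) →+* ℂ)) := by
    rw [Fintype.card_fin, card_index, ← h2d, hK]
  obtain ⟨q, hq⟩ : ∃ q : Fin (K + 1) → Fin (m + 1) × ((F : Type) →+* ℂ), Function.Injective q :=
    ⟨_, (Fintype.equivOfCardEq hcard).injective⟩
  -- `H^{K+1}(A′, ℂ)` is the line spanned by `fmono q`
  have hne : U.fmono xB K q ≠ 0 := U.fmono_ne_zero _ M hN1 hxB hsp hq
  have hC : Module.finrank ℂ (U.CohC (U.cmProd F Θ') (K + 1)) = 1 := by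
    rw [finrank_cohC_succ (hN1 F m Θ' K), finrank_coh_one_cmProd M F Θ', ← h2d, hK, Nat.choose_self]
  obtain ⟨c, hc⟩ := (finrank_eq_one_iff_of_nonzero' _ hne).mp hC (U.castC _ hK ω)
  exact ⟨K, hK, q, c, hq, by rw [hc, castC_castC, castC_self]⟩

/-- the lifted index map of the second block is injective -/
theorem liftB_injective {K : ℕ} {q : Fin (K + 1) → Fin (m + 1) × ((F : Type) →+* ℂ)}
    (hq : Function.Injective q) :
    Function.Injective fun i => ((Fin.natAdd (n + 1) (q i).1 : Fin (n + 1 + (m + 1))), (q i).2) := by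
  intro i i' h
  simp only [Prod.mk.injEq] at h
  exact hq (Prod.ext (Fin.natAdd_inj _ |>.mp h.1) h.2)

/-- **`p_{Y'}^*` is injective on the top degree of `Y'`** — a THEOREM (`ModelAxioms` + N1 + `Fact_dimProd`):
the top class `c · fmono q` pulls back to `c · fmono (lift q) ≠ 0`. -/
theorem pullC_top_ne_zero (M : U.ModelAxioms) (hN1 : U.Fact_cupExterior) (hd : U.Fact_dimProd)
    (hP : U.IsBlockPair F Ξ pA pB) {ω : U.CohC (U.cmProd F (blkB Ξ)) (2 * U.dim (U.cmProd F (blkB Ξ)))}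
    (hω : ω ≠ 0) : U.pullC pB (2 * U.dim (U.cmProd F (blkB Ξ))) ω ≠ 0 := by
  classical
  obtain ⟨β, -, hβ⟩ := exists_integral_injective_eval F
  choose xP hxP _hx0 hsp using fun t => exists_eigenbasis M F (Ξ t) β hβ
  obtain ⟨K, hK, q, c, hq, eω⟩ := U.exists_top_eq_smul_fmono M hN1 hd (Θ' := blkB Ξ)
    (fun i => xP (Fin.natAdd (n + 1) i)) (fun i τ => hxP _ τ) (fun i => hsp _) ω
  have hc0 : c ≠ 0 := by rintro rfl; exact hω (by rw [eω, zero_smul, map_zero])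
  rw [eω, pullC_castC, map_smul, U.pullC_fmono_blkB Ξ xP M.pull_cup hP]
  exact (LinearEquiv.map_ne_zero_iff _).mpr
    (smul_ne_zero hc0 (U.fmono_ne_zero xP M hN1 hxP hsp (liftB_injective hq)))

/-- **(a)_ℂ in positive degree is a THEOREM**: `x ≠ 0` of positive degree and `ω ≠ 0` of top degree `2 dim Y'`
give `p_Y^* x ∪ p_{Y'}^* ω ≠ 0` (`exists_top_eq_smul_fmono` + `boxC_fmono_ne_zero`). -/
theorem boxC_ne_zero_succ (M : U.ModelAxioms) (hN1 : U.Fact_cupExterior) (h5 : U.Fact_cupAssoc)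
    (hd : U.Fact_dimProd) (hP : U.IsBlockPair F Ξ pA pB) {k : ℕ} {x : U.CohC (U.cmProd F (blkA Ξ)) (k + 1)}
    (hx : x ≠ 0) {ω : U.CohC (U.cmProd F (blkB Ξ)) (2 * U.dim (U.cmProd F (blkB Ξ)))} (hω : ω ≠ 0) :
    U.cupC (U.cmProd F Ξ) (k + 1) (2 * U.dim (U.cmProd F (blkB Ξ))) (U.pullC pA (k + 1) x)
      (U.pullC pB (2 * U.dim (U.cmProd F (blkB Ξ))) ω) ≠ 0 := by
  classical
  obtain ⟨β, -, hβ⟩ := exists_integral_injective_eval F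
  choose xP hxP _hx0 hsp using fun t => exists_eigenbasis M F (Ξ t) β hβ
  obtain ⟨K, hK, q, c, hq, eω⟩ := U.exists_top_eq_smul_fmono M hN1 hd (Θ' := blkB Ξ)
    (fun i => xP (Fin.natAdd (n + 1) i)) (fun i τ => hxP _ τ) (fun i => hsp _) ω
  have hc0 : c ≠ 0 := by rintro rfl; exact hω (by rw [eω, zero_smul, map_zero])
  rw [eω, pullC_castC, cupC_castC_right, map_smul, map_smul]
  exact (LinearEquiv.map_ne_zero_iff _).mpr (smul_ne_zero hc0 (U.boxC_fmono_ne_zero Ξ M hN1 h5 hP xP hxP hsp hx hq))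

end BoxPos

/-! ## 4. F7d with complex coefficients: (a)_ℂ and (b)_ℂ for arbitrary nonzero complex top classes -/

section Descent

variable {F : CMField} {n m : ℕ} (Ξ : Fin (n + 1 + (m + 1)) → CMType F)
  {pA : U.Mor (U.cmProd F Ξ) (U.cmProd F (blkA Ξ))} {pB : U.Mor (U.cmProd F Ξ) (U.cmProd F (blkB Ξ))}

/-- base change of the rational box map `e ↦ p_Y^* e ∪ p_{Y'}^* ω₀` -/
theorem box_baseChange (k : ℕ) (ω₀ : U.Coh (U.cmProd F (blkB Ξ)) (2 * U.dim (U.cmProd F (blkB Ξ))))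
    (x : U.CohC (U.cmProd F (blkA Ξ)) k) :
    (((U.cup (U.cmProd F Ξ) k (2 * U.dim (U.cmProd F (blkB Ξ)))).flip
        (U.pull pB (2 * U.dim (U.cmProd F (blkB Ξ))) ω₀)) ∘ₗ U.pull pA k).baseChange ℂ x =
      U.cupC (U.cmProd F Ξ) k (2 * U.dim (U.cmProd F (blkB Ξ))) (U.pullC pA k x)
        (U.pullC pB (2 * U.dim (U.cmProd F (blkB Ξ))) ((1 : ℂ) ⊗ₜ ω₀)) := by
  induction x using TensorProduct.induction_on with
  | zero => simp
  | add a b ha hb => rw [map_add, ha, hb, map_add, map_add, LinearMap.add_apply]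
  | tmul c e =>
    rw [LinearMap.baseChange_tmul, LinearMap.comp_apply, LinearMap.flip_apply, pullC_tmul, pullC_tmul, cupC_tmul,
      mul_one]

/-- complexified pullback of `c ⊗ ω₀` is `c` times that of `1 ⊗ ω₀` -/
theorem pullC_tmul_eq_smul {X Y : U.Var} (f : U.Mor X Y) (k : ℕ) (c : ℂ) (ω₀ : U.Coh Y k) :
    U.pullC f k (c ⊗ₜ ω₀) = c • U.pullC f k ((1 : ℂ) ⊗ₜ ω₀) := by
  rw [pullC_tmul, pullC_tmul, TensorProduct.smul_tmul', smul_eq_mul, mul_one]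

/-- **(a)_ℂ**: `p_Y^* x ∪ p_{Y'}^* ω = 0 ⇒ x = 0` for complex `x` and any nonzero COMPLEX top class `ω` of `Y'`. -/
theorem boxC_eq_zero (M : U.ModelAxioms) (hN1 : U.Fact_cupExterior) (hd : U.Fact_dimProd)
    (h7d : U.Fact_gysinDescent) (hP : U.IsBlockPair F Ξ pA pB) {k : ℕ} {x : U.CohC (U.cmProd F (blkA Ξ)) k}
    {ω : U.CohC (U.cmProd F (blkB Ξ)) (2 * U.dim (U.cmProd F (blkB Ξ)))} (hω : ω ≠ 0)
    (h : U.cupC (U.cmProd F Ξ) k (2 * U.dim (U.cmProd F (blkB Ξ))) (U.pullC pA k x)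
      (U.pullC pB (2 * U.dim (U.cmProd F (blkB Ξ))) ω) = 0) : x = 0 := by
  obtain ⟨ω₀, hω₀, hgen⟩ := U.exists_top_generator M hN1 hd F (blkB Ξ)
  obtain ⟨c, rfl⟩ := hgen ω
  have hc : c ≠ 0 := by rintro rfl; exact hω (TensorProduct.zero_tmul _ _)
  rw [pullC_tmul_eq_smul, map_smul, ← box_baseChange, smul_eq_zero] at h
  rcases h with h | h
  · exact absurd h hc
  · refine baseChange_injective ?_ (h.trans (map_zero _).symm)
    refine (injective_iff_map_eq_zero _).mpr fun e he => (h7d F n m Ξ pA pB hP ω₀ hω₀).1 k e ?_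
    simpa using he

/-- **(b)_ℂ**: `p_Y^* x ∪ p_{Y'}^* ω ∈ Alg^{p+d}(P) ⊗ ℂ ⇒ x ∈ Alg^p(Y) ⊗ ℂ` for complex `x` and any nonzero complex
top class `ω` of `Y'` (flat descent `mem_baseChange_of_baseChange_map_mem` applied to the rational F7d (b)). -/
theorem mem_algC_of_boxC_mem (M : U.ModelAxioms) (hN1 : U.Fact_cupExterior) (hd : U.Fact_dimProd)
    (h7d : U.Fact_gysinDescent) (hP : U.IsBlockPair F Ξ pA pB) {p : ℕ} {x : U.CohC (U.cmProd F (blkA Ξ)) (2 * p)}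
    {ω : U.CohC (U.cmProd F (blkB Ξ)) (2 * U.dim (U.cmProd F (blkB Ξ)))} (hω : ω ≠ 0)
    (hdeg : 2 * p + 2 * U.dim (U.cmProd F (blkB Ξ)) = 2 * (p + U.dim (U.cmProd F (blkB Ξ))))
    (h : U.castC (U.cmProd F Ξ) hdeg (U.cupC (U.cmProd F Ξ) (2 * p) (2 * U.dim (U.cmProd F (blkB Ξ)))
      (U.pullC pA (2 * p) x) (U.pullC pB (2 * U.dim (U.cmProd F (blkB Ξ))) ω)) ∈
        U.algC (U.cmProd F Ξ) (p + U.dim (U.cmProd F (blkB Ξ)))) :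
    x ∈ U.algC (U.cmProd F (blkA Ξ)) p := by
  obtain ⟨ω₀, hω₀, hgen⟩ := U.exists_top_generator M hN1 hd F (blkB Ξ)
  obtain ⟨c, rfl⟩ := hgen ω
  have hc : c ≠ 0 := by rintro rfl; exact hω (TensorProduct.zero_tmul _ _)
  rw [pullC_tmul_eq_smul, map_smul, map_smul, Submodule.smul_mem_iff _ hc, ← box_baseChange,
    ← castCoh_baseChange, ← LinearMap.comp_apply, ← LinearMap.baseChange_comp] at h
  exact mem_baseChange_of_baseChange_map_mem _ _ (U.alg (U.cmProd F (blkA Ξ)) p)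
    (fun e he => (h7d F n m Ξ pA pB hP ω₀ hω₀).2 p e he) h

/-- **Künneth non-degeneracy from F7d** (replaces `box_ne_zero`, whose hypothesis was `∫ (y ∪ y') ≠ 0`):
`x ≠ 0` and `y ∪ y' ≠ 0` of top degree ⇒ `p_Y^* x ∪ p_{Y'}^* y ≠ 0`, because
`(p_Y^* x ∪ p_{Y'}^* y) ∪ p_{Y'}^* y' = p_Y^* x ∪ p_{Y'}^*(y ∪ y')` (F5, M3) and (a)_ℂ. -/
theorem box_ne_zero_of_descent (M : U.ModelAxioms) (hN1 : U.Fact_cupExterior) (h5 : U.Fact_cupAssoc)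
    (hd : U.Fact_dimProd) (h7d : U.Fact_gysinDescent) (hP : U.IsBlockPair F Ξ pA pB)
    {k : ℕ} {x : U.CohC (U.cmProd F (blkA Ξ)) k} (hx : x ≠ 0) {i j : ℕ}
    (y : U.CohC (U.cmProd F (blkB Ξ)) i) (y' : U.CohC (U.cmProd F (blkB Ξ)) j)
    (hij : i + j = 2 * U.dim (U.cmProd F (blkB Ξ))) (hyy : U.cupC _ i j y y' ≠ 0) :
    U.cupC (U.cmProd F Ξ) k i (U.pullC pA k x) (U.pullC pB i y) ≠ 0 := by
  intro hz
  obtain ⟨ω, hω⟩ : ∃ ω, ω = U.castC _ hij (U.cupC _ i j y y') := ⟨_, rfl⟩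
  have hωback : U.cupC _ i j y y' = U.castC _ hij.symm ω := by rw [hω, castC_castC, castC_self]
  have hω0 : ω ≠ 0 := by rw [hω]; exact (LinearEquiv.map_ne_zero_iff _).mpr hyy
  have calc1 : U.cupC (U.cmProd F Ξ) (k + i) j
      (U.cupC (U.cmProd F Ξ) k i (U.pullC pA k x) (U.pullC pB i y)) (U.pullC pB j y') =
      U.castC _ (by omega : k + 2 * U.dim (U.cmProd F (blkB Ξ)) = k + i + j)
        (U.cupC (U.cmProd F Ξ) k (2 * U.dim (U.cmProd F (blkB Ξ))) (U.pullC pA k x)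
          (U.pullC pB (2 * U.dim (U.cmProd F (blkB Ξ))) ω)) := by
    rw [cupC_assoc U h5, ← pullC_cupC U M.pull_cup, hωback, pullC_castC, cupC_castC_right]
    simp only [castC_castC]
  rw [hz, map_zero, LinearMap.zero_apply] at calc1
  have h0 : U.cupC (U.cmProd F Ξ) k (2 * U.dim (U.cmProd F (blkB Ξ))) (U.pullC pA k x)
      (U.pullC pB (2 * U.dim (U.cmProd F (blkB Ξ))) ω) = 0 :=
    (LinearEquiv.map_eq_zero_iff _).mp calc1.symm
  exact hx (U.boxC_eq_zero Ξ M hN1 hd h7d hP hω0 h0)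

end Descent

/-! ## 5. The trace-free partner of a weight vector (complementary eigen-monomial) -/

section Partner

variable {F : CMField} {m : ℕ} (Θ' : Fin (m + 1) → CMType F)

/-- A nonzero weight vector `y` of non-full weight `S'` in degree `l + 1` is `c · fmono p` (`c ≠ 0`); its partner is
the COMPLEMENTARY eigen-monomial `fmono p'` (weight `S'ᶜ`), and `fmono p' ∪ y`, `y ∪ fmono p'` are nonzero multiples
of TOP monomials — nonzero by `fmono_ne_zero` (weight spaces are lines; no trace). -/
theorem exists_partner_mono' (M : U.ModelAxioms) (hN1 : U.Fact_cupExterior) (h5 : U.Fact_cupAssoc)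
    (hd : U.Fact_dimProd) {l : ℕ} {S' : Fin (m + 1) → Finset ((F : Type) →+* ℂ)}
    {y : U.CohC (U.cmProd F Θ') (l + 1)} (hy : U.IsWeightVector F Θ' S' (l + 1) y) (hy0 : y ≠ 0)
    (hS' : S' ≠ fun _ => Finset.univ) :
    ∃ (l' : ℕ) (y' : U.CohC (U.cmProd F Θ') (l' + 1)), l' + 1 + (l + 1) = 2 * U.dim (U.cmProd F Θ') ∧
      U.IsWeightVector F Θ' (fun i => (S' i)ᶜ) (l' + 1) y' ∧
      U.cupC (U.cmProd F Θ') (l' + 1) (l + 1) y' y ≠ 0 ∧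
      U.cupC (U.cmProd F Θ') (l + 1) (l' + 1) y y' ≠ 0 := by
  obtain ⟨β, -, hβ⟩ := exists_integral_injective_eval F
  choose xB hxB _hx0 hsp using fun i => exists_eigenbasis M F (Θ' i) β hβ
  obtain ⟨p, hp, hwt, c, rfl⟩ := U.exists_eq_smul_fmono xB M hN1 hxB hsp hy hy0
  have hc : c ≠ 0 := by rintro rfl; exact hy0 (zero_smul _ _)
  have hns : ¬Function.Surjective p := fun hs => hS' (hwt.symm.trans (wtOf_eq_univ_of_surjective hs))
  obtain ⟨l', p', hp', h1, h2, hcard⟩ := exists_compl_enum p hp hns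
  have hdeg : l' + 1 + (l + 1) = 2 * U.dim (U.cmProd F Θ') := by
    rw [hcard, card_index, two_mul_dim_cmProd_of_dimProd M hd]
  have hwt' : wtOf l' p' = fun i => (S' i)ᶜ := by rw [wtOf_eq_compl h1 h2, hwt]
  have hinj1 : Function.Injective (Fin.append p' p : Fin (l' + 1 + (l + 1)) → _) :=
    Fin.append_injective_iff.mpr ⟨hp', hp, fun i j h => h1 i ⟨j, h.symm⟩⟩
  have hinj2 : Function.Injective (Fin.append p p' : Fin (l + 1 + (l' + 1)) → _) :=
    Fin.append_injective_iff.mpr ⟨hp, hp', fun i j h => h1 j ⟨i, h⟩⟩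
  refine ⟨l', U.fmono xB l' p', hdeg, ?_, ?_, ?_⟩
  · rw [← hwt']; exact isWeightVector_fmono xB M hxB l' p' hp'
  · rw [map_smul, U.cupC_fmono_fmono xB h5]
    exact smul_ne_zero hc (U.fmono_ne_zero xB M hN1 hxB hsp hinj1)
  · rw [map_smul, LinearMap.smul_apply, U.cupC_fmono_fmono xB h5]
    exact smul_ne_zero hc (U.fmono_ne_zero xB M hN1 hxB hsp hinj2)

/-- **The dual partner in even degrees** (conclusion of F6 `Fact_weightDual` with `∫ (w' ∪ w) ≠ 0` replaced by
`w' ∪ w ≠ 0`), for `0 < q` and non-full weight. -/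
theorem weightDual_of_descent (M : U.ModelAxioms) (hN1 : U.Fact_cupExterior) (h5 : U.Fact_cupAssoc)
    (hd : U.Fact_dimProd) (q : ℕ) (S' : Fin (m + 1) → Finset ((F : Type) →+* ℂ))
    (w : U.CohC (U.cmProd F Θ') (2 * q)) (hw0 : w ≠ 0) (hw : U.IsWeightVector F Θ' S' (2 * q) w) (hq : 0 < q)
    (hS' : S' ≠ fun _ => Finset.univ) :
    q < U.dim (U.cmProd F Θ') ∧
    ∃ w' : U.CohC (U.cmProd F Θ') (2 * (U.dim (U.cmProd F Θ') - q)),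
      U.IsWeightVector F Θ' (fun i => (S' i)ᶜ) (2 * (U.dim (U.cmProd F Θ') - q)) w' ∧
      U.cupC (U.cmProd F Θ') _ _ w' w ≠ 0 ∧ U.cupC (U.cmProd F Θ') _ _ w w' ≠ 0 := by
  obtain ⟨l, hl⟩ : ∃ l, 2 * q = l + 1 := ⟨2 * q - 1, by omega⟩
  obtain ⟨l', y', hdeg, hw', h1, h2⟩ := U.exists_partner_mono' Θ' M hN1 h5 hd
    (U.isWeightVector_castC F Θ' S' hl hw) (fun h => hw0 ((LinearEquiv.map_eq_zero_iff _).mp h)) hS'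
  have e1 : l' + 1 = 2 * (U.dim (U.cmProd F Θ') - q) := by omega
  have e : w = U.castC _ hl.symm (U.castC _ hl w) := by rw [castC_castC, castC_self]
  refine ⟨by omega, U.castC _ e1 y', U.isWeightVector_castC F Θ' _ e1 hw', ?_, ?_⟩
  · rw [e, cupC_castC_left, cupC_castC_right, castC_castC]
    exact (LinearEquiv.map_ne_zero_iff _).mpr h1
  · rw [e, cupC_castC_left, cupC_castC_right, castC_castC]
    exact (LinearEquiv.map_ne_zero_iff _).mpr h2

end Partner

end Universe

end HodgeCM

end
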